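import Summits.QuantumFields.BalabanUV.Beta.GAN24.CoDressedColumnPairing

/-!
# `BalabanUV.Beta.D1BFx.TwoBondWardPairing` — road «BF-x» for binder row D1, slot (K), junction (J3), brick (B2) second half, GENERIC CORE:
# **THE PAIRING OF A WARD-DIVERGENCE-FREE TWO-BOND TABLE WITH TWO WEIGHT FAMILIES IS INVARIANT UNDER GRADIENT SHIFTS OF THE WEIGHTS**

The one-loop words of the road are pairings `Σ_{(κ,u)} Σ_{(l,u′)} w₁(κ,u)·w₂(l,u′)·H((κ,u),(l,u′))` of a fine two-bond table `H` (e.g. the fine Hessian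
`ReducedKernelSandwichLeg.fineHessA A S Wf` of a leg, a stencil family and a two-bond table) with two weight families (the `ℋ`-columns `colH K`).
The road's block-mean axial dressing replaces each weight family by `w − grad χ` (gan24-leaf-05's `CoDressedColumnPairing.colH_coDressKBmAt_eq_sub_grad`:
`colH (coDressKBmAt ρ N K) = colH K − grad (bmGaugeAt ρ (colH K) N)`).  When the table is WARD-DIVERGENCE-FREE in each bond
(`Σ_κ (H((κ,u),b′) − H((κ,u−e_κ),b′)) = 0`, `Σ_l (H(b,(l,u′)) − H(b,(l,u′−e_l))) = 0` — for the fine Hessian: leaf-01 g2's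
`FineHessianWard.divFree_fineHessA_of_wardLaws` from the jet-level laws (W1)∕(W2)), the gradient shifts drop out by lattice summation by parts
(`CoDressedColumnPairing.sum_tsum_grad_mul_eq_neg_tsum_mul_div`): **`pair H (w₁ − grad χ₁) (w₂ − grad χ₂) = pair H w₁ w₂`** (`pairing_grad_shift_invariant`).
This is the «F₂[A − dφ, A′ − dφ′] = F₂[A, A′]» step (W-iii)–(W-iv) of the row owner an2 g40's ruling R-D1-g40-1 ∕ the road owner's A-1, at the
level of the fine-table pairing, with the analytic conditions spelled out (bounded potentials, bounded weights, summable rows, and summability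
in the first base point of the dressed second-slot contraction).  The INSTANCE for the completed ghost data `(Ggh, SghAt, WghAt)` and the road's
two weight families `colH K₀` ∕ `colH G₀` is the sequel (`GhostWardTransversal`).

HONEST DEPENDENCY (cell records, verbatim): «continuum YM on T⁴ ⇐ BetaPertH ∧ nine spine estimates (0/9 proved); BetaPertH ⇐ (D1) ∧ (D4) ∧
CAP+tail; G-an2-4 gates asym, D1 and NE2/3/4.»  HONEST FRAMING (cell contract, verbatim): «discharging `BetaPertH` makes Bałaban's UV stability
UNCONDITIONAL — a real constructive-QFT result; it is NOT the continuum limit and NOT the Clay problem.»  THIS MODULE DISCHARGES NOTHING of the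
wall: [folklore] `tsum` bookkeeping (generic dimension `d + 1`); the divergence-freeness, the bounds and the summabilities are HYPOTHESES; no object
of Bałaban's appears.  No definition, no `def … : Prop`, no notation, nothing cited, 0 sorry.  0 root-level binders of row D1 discharged
(hW ∕ hR-sockets ∕ hSX-socket ∕ D1Tel ∕ D1Rep — 0); (J3) remains DISPLAYED; (K) NOT closed; NOT D1, NOT `BetaPertH`, NOT continuum, NOT Clay.

ABSOLUTE RULE (cell charter, verbatim): «No internally-minted statement may enter as a cited fact. Every hypothesis is either kernel-proved in
this package or a verbatim quotation of a PUBLISHED theorem with page reference. The manuscript(s) under audit are NOT citable for their own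
disputed steps — they are the thing under adjudication; programme-internal (2001/route/tribunal) claims are never citable.»

Unit `b2b-balaban-beta-d1-formalise-leaf-04` (gen 21), D1 formalisation swarm leaf prover 04, road «BF-x»; (B2) second half per R-D1-g40-1 ∕ ρ-g19-4 (journal).
-/

noncomputable section

open Finset
open scoped BigOperators
open Literature.MathematicalPhysics.QuantumFieldTheory
open Literature.MathematicalPhysics.QuantumFieldTheory.Balaban1983to89
open Literature.MathematicalPhysics.QuantumFieldTheory.Balaban1983to89.Beta
open AffineAveraging (Form0 Form1 unitVec)
open Summit.QuantumFields.BalabanUV.Beta.GAN24.CoDressedColumnPairing (sum_tsum_grad_mul_eq_neg_tsum_mul_div)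

namespace Summit.QuantumFields.BalabanUV.Beta.D1BFx.TwoBondWardPairing

variable {d : ℕ}

/-! ## §1 One bond: a divergence-free summable one-form pairs to zero with every bounded gradient -/

/-- [folklore] Bounded × summable is summable (real series are absolutely summable). -/
theorem summable_bdd_mul {f g : (Fin (d + 1) → ℤ) → ℝ} {B : ℝ} (hf : ∀ u, |f u| ≤ B) (hg : Summable g) :
    Summable fun u => f u * g u :=
  Summable.of_norm_bounded (hg.abs.mul_left B) fun u => by
    rw [Real.norm_eq_abs, abs_mul]
    exact mul_le_mul_of_nonneg_right (hf u) (abs_nonneg _)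

/-- [folklore] **A BOUNDED GRADIENT PAIRS TO ZERO WITH A DIVERGENCE-FREE SUMMABLE ONE-FORM**: if `|χ| ≤ B`, every `g κ` is summable and
`Σ_κ (g κ u − g κ (u − e_κ)) = 0` for all `u`, then `Σ_κ Σ'_u (χ(u + e_κ) − χ(u))·g κ u = 0` (summation by parts, `sum_tsum_grad_mul_eq_neg_tsum_mul_div`). -/
theorem sum_tsum_grad_mul_eq_zero_of_divFree {χ : Form0 (d + 1) ℝ} {g : Form1 (d + 1) ℝ} {B : ℝ} (hχ : ∀ u, |χ u| ≤ B)
    (hg : ∀ κ, Summable (g κ)) (hdiv : ∀ u, ∑ κ : Fin (d + 1), (g κ u - g κ (u - unitVec κ)) = 0) :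
    ∑ κ : Fin (d + 1), ∑' u : Fin (d + 1) → ℤ, (χ (u + unitVec κ) - χ u) * g κ u = 0 := by
  rw [sum_tsum_grad_mul_eq_neg_tsum_mul_div hχ hg]
  simp only [hdiv, mul_zero, tsum_zero, neg_zero]

/-- [folklore] **ONE WEIGHT SLOT: `Σ_κ Σ'_u (w − grad χ)(κ,u)·g κ u = Σ_κ Σ'_u w(κ,u)·g κ u`** for a bounded weight `w`, a bounded potential `χ` and a
divergence-free summable one-form `g`. -/
theorem sum_tsum_sub_grad_mul_eq {χ : Form0 (d + 1) ℝ} {w g : Form1 (d + 1) ℝ} {B Bw : ℝ} (hχ : ∀ u, |χ u| ≤ B) (hw : ∀ κ u, |w κ u| ≤ Bw)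
    (hg : ∀ κ, Summable (g κ)) (hdiv : ∀ u, ∑ κ : Fin (d + 1), (g κ u - g κ (u - unitVec κ)) = 0) :
    ∑ κ : Fin (d + 1), ∑' u : Fin (d + 1) → ℤ, (w κ u - (χ (u + unitVec κ) - χ u)) * g κ u
      = ∑ κ : Fin (d + 1), ∑' u : Fin (d + 1) → ℤ, w κ u * g κ u := by
  have hB : 0 ≤ B := (abs_nonneg _).trans (hχ 0)
  have hgrad : ∀ κ u, |χ (u + unitVec κ) - χ u| ≤ 2 * B := fun κ u =>
    (abs_sub _ _).trans (by linarith [hχ (u + unitVec κ), hχ u])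
  have hs1 : ∀ κ, Summable fun u : Fin (d + 1) → ℤ => w κ u * g κ u := fun κ => summable_bdd_mul (hw κ) (hg κ)
  have hs2 : ∀ κ, Summable fun u : Fin (d + 1) → ℤ => (χ (u + unitVec κ) - χ u) * g κ u := fun κ =>
    summable_bdd_mul (hgrad κ) (hg κ)
  have e : ∀ κ, ∑' u : Fin (d + 1) → ℤ, (w κ u - (χ (u + unitVec κ) - χ u)) * g κ u
      = (∑' u : Fin (d + 1) → ℤ, w κ u * g κ u) - ∑' u : Fin (d + 1) → ℤ, (χ (u + unitVec κ) - χ u) * g κ u := by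
    intro κ
    rw [← (hs1 κ).tsum_sub (hs2 κ)]
    exact tsum_congr fun u => by ring
  rw [Finset.sum_congr rfl fun κ _ => e κ, Finset.sum_sub_distrib, sum_tsum_grad_mul_eq_zero_of_divFree hχ hg hdiv, sub_zero]

/-! ## §2 Two bonds: the second-slot contraction of a first-bond divergence-free table is divergence-free -/

section TwoBond

variable (H : Fin (d + 1) → Fin (d + 1) → (Fin (d + 1) → ℤ) → (Fin (d + 1) → ℤ) → ℝ)

/-- [folklore] **THE SECOND-SLOT CONTRACTION `G(κ,u) := Σ_l Σ'_{u′} w(l,u′)·H((κ,u),(l,u′))` OF A FIRST-BOND DIVERGENCE-FREE TABLE IS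
DIVERGENCE-FREE** (bounded `w`, summable rows): `Σ_κ (G(κ,u) − G(κ,u−e_κ)) = 0`. -/
theorem divFree_contraction {w : Form1 (d + 1) ℝ} {Bw : ℝ} (hw : ∀ l u', |w l u'| ≤ Bw)
    (hH : ∀ κ l u, Summable fun u' => H κ l u u')
    (hdiv₁ : ∀ l u' u, ∑ κ : Fin (d + 1), (H κ l u u' - H κ l (u - unitVec κ) u') = 0) (u : Fin (d + 1) → ℤ) :
    ∑ κ : Fin (d + 1), ((∑ l : Fin (d + 1), ∑' u' : Fin (d + 1) → ℤ, w l u' * H κ l u u')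
        - ∑ l : Fin (d + 1), ∑' u' : Fin (d + 1) → ℤ, w l u' * H κ l (u - unitVec κ) u') = 0 := by
  have hs : ∀ κ l v, Summable fun u' : Fin (d + 1) → ℤ => w l u' * H κ l v u' := fun κ l v => summable_bdd_mul (hw l) (hH κ l v)
  have e : ∀ κ, (∑ l : Fin (d + 1), ∑' u' : Fin (d + 1) → ℤ, w l u' * H κ l u u')
      - ∑ l : Fin (d + 1), ∑' u' : Fin (d + 1) → ℤ, w l u' * H κ l (u - unitVec κ) u'
      = ∑ l : Fin (d + 1), ∑' u' : Fin (d + 1) → ℤ, w l u' * (H κ l u u' - H κ l (u - unitVec κ) u') := by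
    intro κ
    rw [← Finset.sum_sub_distrib]
    refine Finset.sum_congr rfl fun l _ => ?_
    rw [← (hs κ l u).tsum_sub (hs κ l (u - unitVec κ))]
    exact tsum_congr fun u' => by ring
  rw [Finset.sum_congr rfl fun κ _ => e κ, Finset.sum_comm]
  refine Finset.sum_eq_zero fun l _ => ?_
  rw [← Summable.tsum_finsetSum (fun κ _ => (hs κ l u).sub (hs κ l (u - unitVec κ)) |>.congr (fun u' => by ring))]
  · refine (tsum_congr fun u' => ?_).trans tsum_zero
    rw [← Finset.mul_sum, hdiv₁ l u' u, mul_zero]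

/-- [folklore] **THE PAIRING IS INVARIANT UNDER GRADIENT SHIFTS OF BOTH WEIGHT FAMILIES**: for a two-bond table `H` with summable rows that is
Ward-divergence-free in EACH bond, bounded weights `w₁ w₂` and bounded potentials `χ₁ χ₂`, and with the dressed second-slot contraction summable in
the first base point:
`Σ_κ Σ'_u (w₁ − grad χ₁)(κ,u)·Σ_l Σ'_{u′} (w₂ − grad χ₂)(l,u′)·H((κ,u),(l,u′)) = Σ_κ Σ'_u w₁(κ,u)·Σ_l Σ'_{u′} w₂(l,u′)·H((κ,u),(l,u′))`. -/
theorem pairing_grad_shift_invariant {w₁ w₂ : Form1 (d + 1) ℝ} {χ₁ χ₂ : Form0 (d + 1) ℝ} {B₁ B₂ B Bw : ℝ}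
    (hw₁ : ∀ κ u, |w₁ κ u| ≤ B₁) (hw₂ : ∀ l u', |w₂ l u'| ≤ B₂) (hχ₁ : ∀ u, |χ₁ u| ≤ B) (hχ₂ : ∀ u', |χ₂ u'| ≤ Bw)
    (hH : ∀ κ l u, Summable fun u' => H κ l u u')
    (hdiv₁ : ∀ l u' u, ∑ κ : Fin (d + 1), (H κ l u u' - H κ l (u - unitVec κ) u') = 0)
    (hdiv₂ : ∀ κ u u', ∑ l : Fin (d + 1), (H κ l u u' - H κ l u (u' - unitVec l)) = 0)
    (hG : ∀ κ, Summable fun u : Fin (d + 1) → ℤ =>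
      ∑ l : Fin (d + 1), ∑' u' : Fin (d + 1) → ℤ, (w₂ l u' - (χ₂ (u' + unitVec l) - χ₂ u')) * H κ l u u') :
    ∑ κ : Fin (d + 1), ∑' u : Fin (d + 1) → ℤ, (w₁ κ u - (χ₁ (u + unitVec κ) - χ₁ u))
        * ∑ l : Fin (d + 1), ∑' u' : Fin (d + 1) → ℤ, (w₂ l u' - (χ₂ (u' + unitVec l) - χ₂ u')) * H κ l u u'
      = ∑ κ : Fin (d + 1), ∑' u : Fin (d + 1) → ℤ, w₁ κ u * ∑ l : Fin (d + 1), ∑' u' : Fin (d + 1) → ℤ, w₂ l u' * H κ l u u' := by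
  -- second slot, pointwise in `(κ, u)`: the gradient of `χ₂` pairs to zero with the divergence-free row `(l, u′) ↦ H((κ,u),(l,u′))`
  have e₂ : ∀ κ u, ∑ l : Fin (d + 1), ∑' u' : Fin (d + 1) → ℤ, (w₂ l u' - (χ₂ (u' + unitVec l) - χ₂ u')) * H κ l u u'
      = ∑ l : Fin (d + 1), ∑' u' : Fin (d + 1) → ℤ, w₂ l u' * H κ l u u' := fun κ u =>
    sum_tsum_sub_grad_mul_eq (g := fun l u' => H κ l u u') hχ₂ hw₂ (fun l => hH κ l u) (fun u' => hdiv₂ κ u u')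
  simp_rw [e₂] at hG ⊢
  -- first slot: the undressed contraction is summable (it equals the dressed one) and divergence-free
  exact sum_tsum_sub_grad_mul_eq (g := fun κ u => ∑ l : Fin (d + 1), ∑' u' : Fin (d + 1) → ℤ, w₂ l u' * H κ l u u') hχ₁ hw₁ hG
    (divFree_contraction H hw₂ hH hdiv₁)

end TwoBond

end Summit.QuantumFields.BalabanUV.Beta.D1BFx.TwoBondWardPairing

end
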